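import Mathlib
import HarnessLib
import Summits.AtomisticToContinuum.Crystallization.Theorems.ChargedEnergyGap.Negative.Unconditional
import Summits.AtomisticToContinuum.Crystallization.Theorems.ChartedPlanarOrderChunkFloor
import Summits.AtomisticToContinuum.Crystallization.Theorems.ChartedPlanarOrderDensityDichotomyDoor

/-!
# Terminal by-name module (post-landing): the proved floor plugged into the density dichotomy

Lands AFTER `Theorems/ChartedPlanarOrderChunkFloor.lean` (Floor♭ from the cluster bound; `Theses`-free helper) and
`Theorems/ChartedPlanarOrderDensityDichotomy.lean` + `…DensityDichotomyDoor.lean` (the node, split at landing).  Content: `ChunkFloor` of the node holds UNCONDITIONALLY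
(`Iff.rfl` transport of `ChartedPlanarOrderChunkFloor.chunkFloor_of_clusterBound` fed with the tree theorem
`ChargedEnergyGapNegative.card_mul_eStar_le : N·e⋆ ≤ E_LJ`), hence beneath the door the residual of record is
`BulkDefectGap ∧ DiluteDefectRate` (plus the lens-3 door pieces).  This leaf is the only `Theses`-coned consumer.

(decomp-a2c lens 2, g21.  Checked pre-landing as the single concatenated unit `g21/bc/combined_g21.lean`, rc 0.)
-/

noncomputable section

namespace Summit.AtomisticToContinuum.Crystallization.Theorems.ChartedPlanarOrderDensityDichotomy

open Summit.AtomisticToContinuum.Crystallization.Theorems.ChartedPlanarOrderRigidityDoor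

/-- **Floor♭ holds** in the node's by-name currency. -/
theorem chunkFloor_holds : ChunkFloor :=
  chunkFloor_iff_text.mpr
    (Summit.AtomisticToContinuum.Crystallization.Theorems.ChartedPlanarOrderChunkFloor.chunkFloor_of_clusterBound
      fun _ _ hy => Summit.AtomisticToContinuum.Crystallization.Theorems.ChargedEnergyGapNegative.card_mul_eStar_le hy)

/-- `R⋆♭ ⟺ RATE′ ⟺ BULK ∧ DILUTE` unconditionally. -/
theorem flat_iff_bulk_and_dilute : DiscreteBarlowRigidityFlat ↔ BulkDefectGap ∧ DiluteDefectRate :=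
  (flat_iff_rate_of_floor chunkFloor_holds).trans rate_iff_bulk_and_dilute

/-- **The residual of record beneath the door, after g21**: DOOR ∧ SparseNull(≤ 1/16) ∧ BindingSurface ∧ WindowCounting ∧
BULK ∧ DILUTE ⟹ VisibleGap (1/50) ∧ PertRegime (1/50). -/
theorem gap_and_pert_1_50_of_bulk_dilute
    (hD : Summit.AtomisticToContinuum.Crystallization.Theses.GrainCoreNetworkSplit.MuEquilibriumDoor)
    (hN : ∀ η : ℝ, 0 < η → η ≤ 1 / 16 → SparseNull η) (hB : BindingSurface) (hW : WindowCounting)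
    (hBu : BulkDefectGap) (hDi : DiluteDefectRate) :
    VisibleGap (1 / 50) ∧ PertRegime (1 / 50) :=
  gap_and_pert_1_50_of_floor_bulk_dilute hD hN hB hW chunkFloor_holds hBu hDi

end Summit.AtomisticToContinuum.Crystallization.Theorems.ChartedPlanarOrderDensityDichotomy

end
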